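import Summits.QuantumFields.YangMills.Theorems.SwapVirialDeficitSwapMeanActionApriori
import HarnessLib

/-!
# The explicit window-uniform Laplace floor `e^{−A_L(b)} ≤ Z₀(b)` and the LARGE-FIELD share of any bounded functional

Two window-uniform bookkeeping facts for the virial window row (fcl-p3 g46's D2 `VirialWindow`; memo2 remark 3):

* ★★ `swap_laplace_floor_uniform` — ABSOLUTE `K ≥ 0`, `β₀ ≥ 1` with `exp(−((9L⁴−1)·log b + K·L⁴·(1+log L))) ≤ Z₀(b) = ∫ e^{−bF^S_0} dμ_L` for EVERY
  `L ≥ 1`, `b ≥ β₀` (the explicit form of ✓`swap_laplace_floor_of_leaderVolume` with ✓`swapCommVolume`'s universal constants and ✓`neg_log_floor_le`);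
* `abs_integral_indicator_mul_exp_le` (`|∫ 𝟙{s ≤ F}·G·e^{−bF} dμ_L| ≤ B·e^{−bs}` for `|G| ≤ B`), ★★★ `largeField_share_le` — for every `L`, `b ≥ β₀`,
  threshold `s` and bounded `G`:  `|∫ 𝟙{s ≤ F^S_0}·G·e^{−bF^S_0} dμ_L| ≤ B·exp(−bs + (9L⁴−1) log b + K L⁴(1+log L))·Z₀(b)`:
  the LARGE-FIELD share of any bounded functional is negligible against `Z₀` on a polynomial window `b·s ≫ L⁴ log b` — the rigorous form of
  "the remainder `b⟪R⟫` off the Taylor region needs no relative precision".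

HONEST LABEL: crude window-uniform bookkeeping for a DRAFT line; `VirialWindow` ∕ ⟨24197⟩ (window-uniform) OPEN; ⟨24194⟩ ∕ ⟨24497⟩ OPEN; own crux
⟨22884⟩ OPEN (blocked-on ⟨19935⟩); no crux, rung of record or summit is proved; the Yang–Mills mass gap is NOT proved; no summit is proved by a line.
THEOREMS ONLY (0 `def`, 0 `sorry`), standard axioms.  Width seat ym-line-sfw-p2-w2 g57 (cell ym-idea-1, free hands), `--supports stmt-QuantumFields-24197`.
References: [cite: tHooft1979]; [cite: Luscher1983, §2]; [cite: Griffiths1964]; [folklore].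
-/

set_option autoImplicit false

noncomputable section

open MeasureTheory Set Filter
open scoped BigOperators Topology
open Literature.MathematicalPhysics.QuantumFieldTheory hiding SU2
open Literature.MathematicalPhysics.QuantumLattice

namespace Summit.QuantumFields.YangMills.Theorems.SwapVirialDeficit.SwapRing

open Summit.QuantumFields.YangMills.Theorems.FemtoTransferGap
open Summit.QuantumFields.YangMills.Theorems.FemtoTransferGap.TT
open Summit.QuantumFields.YangMills.Theorems.FemtoTransferGap.TT.SectorSmooth
open Summit.QuantumFields.YangMills.Theorems.VirialFluxGap.RingDeficit

/-- ★★ **WINDOW-UNIFORM EXPLICIT LAPLACE FLOOR** of the σ-glued principal-sector deficit: there are ABSOLUTE `K ≥ 0`, `β₀ ≥ 1` with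
`exp(−((9L⁴ − 1)·log b + K·L⁴·(1 + log L))) ≤ Z₀(b) = ∫ e^{−bF^S_0} dμ_L` for EVERY `L ≥ 1` and `b ≥ β₀`
(✓`swap_laplace_floor_of_leaderVolume` with the universal constants of ✓`swapCommVolume`, ✓`neg_log_floor_le`). [cite: tHooft1979] [cite: Luscher1983, §2] -/
theorem swap_laplace_floor_uniform :
    ∃ K : ℝ, 0 ≤ K ∧ ∃ β₀ : ℝ, 1 ≤ β₀ ∧ ∀ (L : ℕ) [NeZero L] (b : ℝ), β₀ ≤ b →
      Real.exp (-((9 * (L : ℝ) ^ 4 - 1) * Real.log b + K * (L : ℝ) ^ 4 * (1 + Real.log L))) ≤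
        ∫ p, Real.exp (-(b * swapRingDeficit L (fun _ => false) p)) ∂(ringMeasure L) := by
  obtain ⟨c, hc, s₀, hs₀, hs₀1, hvol⟩ := swapCommVolume
  refine ⟨1 + |Real.log c| + 6 * Real.log 34 + 9 * Real.log 1200 + 36, by positivity, max 1 (1200 * s₀ ^ 2)⁻¹, le_max_left _ _,
    fun L _ b hb => ?_⟩
  have hb1 : 1 ≤ b := (le_max_left _ _).trans hb
  have hL : (1 : ℝ) ≤ L := by exact_mod_cast NeZero.one_le
  have hL4 : (1 : ℝ) ≤ (L : ℝ) ^ 4 := one_le_pow₀ hL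
  have hβ₀ : (1200 * (L : ℝ) ^ 4 * s₀ ^ 2)⁻¹ ≤ b := by
    refine le_trans ?_ ((le_max_right _ _).trans hb)
    exact inv_anti₀ (by positivity) (by nlinarith [sq_nonneg s₀, mul_pos (by norm_num : (0:ℝ) < 1200) (pow_pos hs₀ 2)])
  have hfloor := swap_laplace_floor_of_leaderVolume (L := L) hs₀ hs₀1 hvol hb1 hβ₀
  have hK := neg_log_floor_le (L := L) hc hb1
  have hpos : 0 < Real.exp (-1) * (c * (1 / 34 : ℝ) ^ (6 * L ^ 4 - 3) * ((1200 * (L : ℝ) ^ 4 * b) ^ (9 * L ^ 4 - 1))⁻¹) := by positivity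
  calc Real.exp (-((9 * (L : ℝ) ^ 4 - 1) * Real.log b + (1 + |Real.log c| + 6 * Real.log 34 + 9 * Real.log 1200 + 36) * (L : ℝ) ^ 4 * (1 + Real.log L)))
      ≤ Real.exp (Real.log (Real.exp (-1) * (c * (1 / 34 : ℝ) ^ (6 * L ^ 4 - 3) * ((1200 * (L : ℝ) ^ 4 * b) ^ (9 * L ^ 4 - 1))⁻¹))) :=
        Real.exp_le_exp.2 (by linarith)
    _ = Real.exp (-1) * (c * (1 / 34 : ℝ) ^ (6 * L ^ 4 - 3) * ((1200 * (L : ℝ) ^ 4 * b) ^ (9 * L ^ 4 - 1))⁻¹) := Real.exp_log hpos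
    _ ≤ _ := hfloor

variable {L : ℕ} [NeZero L]

/-- The large-field part of a bounded functional against `e^{−bF}`: `|∫ 𝟙{s ≤ F}·G·e^{−bF} dμ_L| ≤ B·e^{−bs}` (`|G| ≤ B`, `b ≥ 0`, `μ_L` a probability measure).
[folklore] -/
theorem abs_integral_indicator_mul_exp_le (z : Fin 3 → Bool) {G : (Fin (2 * L - 1 + 1) → GaugeConfig 3 L SU2) × (Site 3 L → SU2) → ℝ}
    {B : ℝ} (hbd : ∀ p, |G p| ≤ B) {b : ℝ} (hb : 0 ≤ b) (s : ℝ) :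
    |∫ p, {p | s ≤ swapRingDeficit L z p}.indicator G p * Real.exp (-(b * swapRingDeficit L z p)) ∂(ringMeasure L)| ≤ B * Real.exp (-(b * s)) := by
  haveI := isProbabilityMeasure_ringMeasure (L := L)
  have hB : 0 ≤ B := (abs_nonneg _).trans (hbd (Classical.arbitrary _))
  have hS : MeasurableSet {p : (Fin (2 * L - 1 + 1) → GaugeConfig 3 L SU2) × (Site 3 L → SU2) | s ≤ swapRingDeficit L z p} :=
    measurableSet_le measurable_const (measurable_swapRingDeficit z)
  have hpt : ∀ p, |{p | s ≤ swapRingDeficit L z p}.indicator G p * Real.exp (-(b * swapRingDeficit L z p))| ≤ B * Real.exp (-(b * s)) := fun p => by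
    rw [abs_mul, abs_of_pos (Real.exp_pos _)]
    by_cases hp : p ∈ {p | s ≤ swapRingDeficit L z p}
    · rw [Set.indicator_of_mem hp]
      have hs : s ≤ swapRingDeficit L z p := hp
      exact mul_le_mul (hbd p) (Real.exp_le_exp.2 (by nlinarith)) (Real.exp_pos _).le hB
    · rw [Set.indicator_of_notMem hp, abs_zero, zero_mul]; positivity
  calc |∫ p, {p | s ≤ swapRingDeficit L z p}.indicator G p * Real.exp (-(b * swapRingDeficit L z p)) ∂(ringMeasure L)|
      ≤ ∫ p, |{p | s ≤ swapRingDeficit L z p}.indicator G p * Real.exp (-(b * swapRingDeficit L z p))| ∂(ringMeasure L) := abs_integral_le_integral_abs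
    _ ≤ ∫ _p, B * Real.exp (-(b * s)) ∂(ringMeasure L) := by
        refine integral_mono_of_nonneg (ae_of_all _ fun p => abs_nonneg _) (integrable_const _) (ae_of_all _ hpt)
    _ = B * Real.exp (-(b * s)) := by simp

/-- ★★★ **THE LARGE-FIELD SHARE IS NEGLIGIBLE ON A POLYNOMIAL WINDOW, UNIFORMLY IN `L`**: with the absolute `K, β₀` of `swap_laplace_floor_uniform`,
for every `L ≥ 1`, `b ≥ β₀`, threshold `s`, and every `G` with `|G| ≤ B` (no measurability needed),
`|∫ 𝟙{s ≤ F^S_0}·G·e^{−bF^S_0} dμ_L| ≤ B·exp(−b·s + (9L⁴−1)·log b + K·L⁴·(1+log L))·Z₀(b)`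
— e.g. with `s = L^{−p}` the factor is `≤ ε` as soon as `b ≥ 2L^p((9L⁴−1) log b + K L⁴(1+log L) + log(B/ε))`.  This is the rigorous form of the
large-field half of memo2 remark 3 (the remainder `b⟪R⟫` off the Taylor region needs no relative precision). [cite: tHooft1979] [cite: Luscher1983, §2] -/
theorem largeField_share_le :
    ∃ K : ℝ, 0 ≤ K ∧ ∃ β₀ : ℝ, 1 ≤ β₀ ∧ ∀ (L : ℕ) [NeZero L] (b : ℝ), β₀ ≤ b → ∀ (s : ℝ)
      (G : (Fin (2 * L - 1 + 1) → GaugeConfig 3 L SU2) × (Site 3 L → SU2) → ℝ) (B : ℝ), (∀ p, |G p| ≤ B) →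
        |∫ p, {p | s ≤ swapRingDeficit L (fun _ => false) p}.indicator G p * Real.exp (-(b * swapRingDeficit L (fun _ => false) p)) ∂(ringMeasure L)| ≤
          B * Real.exp (-(b * s) + ((9 * (L : ℝ) ^ 4 - 1) * Real.log b + K * (L : ℝ) ^ 4 * (1 + Real.log L))) *
            ∫ p, Real.exp (-(b * swapRingDeficit L (fun _ => false) p)) ∂(ringMeasure L) := by
  obtain ⟨K, hK, β₀, hβ₀, hfloor⟩ := swap_laplace_floor_uniform
  refine ⟨K, hK, β₀, hβ₀, fun L _ b hb s G B hbd => ?_⟩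
  have hb0 : 0 ≤ b := by linarith
  have hB : 0 ≤ B := (abs_nonneg _).trans (hbd (Classical.arbitrary _))
  have h1 := abs_integral_indicator_mul_exp_le (L := L) (fun _ => false) hbd hb0 s
  have h2 := hfloor L b hb
  have hZ := (Real.exp_pos (-((9 * (L : ℝ) ^ 4 - 1) * Real.log b + K * (L : ℝ) ^ 4 * (1 + Real.log L)))).le
  calc |∫ p, {p | s ≤ swapRingDeficit L (fun _ => false) p}.indicator G p * Real.exp (-(b * swapRingDeficit L (fun _ => false) p)) ∂(ringMeasure L)|
      ≤ B * Real.exp (-(b * s)) := h1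
    _ = B * Real.exp (-(b * s) + ((9 * (L : ℝ) ^ 4 - 1) * Real.log b + K * (L : ℝ) ^ 4 * (1 + Real.log L))) *
          Real.exp (-((9 * (L : ℝ) ^ 4 - 1) * Real.log b + K * (L : ℝ) ^ 4 * (1 + Real.log L))) := by
        rw [mul_assoc, ← Real.exp_add]; ring_nf
    _ ≤ _ := mul_le_mul_of_nonneg_left h2 (mul_nonneg hB (Real.exp_pos _).le)

end Summit.QuantumFields.YangMills.Theorems.SwapVirialDeficit.SwapRing

end
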